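import Summits.AtomisticToContinuum.Crystallization.Theorems.ChargedEnergyGapStressFreeFccA
import HarnessLib

/-!
# «StressFreeFcc» P-J FCC-W (lens-3 g61) — part 2 of 5 (sequel of `…ChargedEnergyGapStressFreeFccA`)

Split for the 400-line cap by the landing lane (hand-2 g31); the module docstring of part 1 (`…ChargedEnergyGapStressFreeFccA`) describes the whole node.  Same namespace; all FQNs unchanged.
0 sorry; standard axioms.
-/

noncomputable section
open scoped Classical
open Literature.MathematicalPhysics.StatisticalMechanics
open Literature.Geometry.DiscreteGeometry
open Summit.AtomisticToContinuum.Crystallization.Theses.PricedLinkCensus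
open Summit.AtomisticToContinuum.Crystallization.Theorems.ChargedEnergyGapNegative

namespace Summit.AtomisticToContinuum.Crystallization.Theorems.ChargedEnergyGapChartDial

namespace Fcc

/-! ## The fcc configuration is a BARLOW IMAGE: an explicit rotation from stacking coordinates to cubic coordinates -/

section Barlow

/-- `sqrt2_sq` (docstring added by the landing lane; see the module docstring). [formal bookkeeping] (dedup gate: public twins Literature.Geometry.DiscreteGeometry.sqrt_two_sq/sqrt_three_sq (LayerShells, not imported here), …sqrt2_pos/sqrt3_pos in unrelated modules; kept PRIVATE (private copies in the sequel parts that use them)) -/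
private theorem sqrt2_sq : Real.sqrt 2 ^ 2 = 2 := Real.sq_sqrt (by norm_num)
/-- `sqrt3_sq` (docstring added by the landing lane; see the module docstring). [formal bookkeeping] (dedup gate: public twins Literature.Geometry.DiscreteGeometry.sqrt_two_sq/sqrt_three_sq (LayerShells, not imported here), …sqrt2_pos/sqrt3_pos in unrelated modules; kept PRIVATE (private copies in the sequel parts that use them)) -/
private theorem sqrt3_sq : Real.sqrt 3 ^ 2 = 3 := Real.sq_sqrt (by norm_num)
/-- `sqrt2_pos` (docstring added by the landing lane; see the module docstring). [formal bookkeeping] (dedup gate: public twins Literature.Geometry.DiscreteGeometry.sqrt_two_sq/sqrt_three_sq (LayerShells, not imported here), …sqrt2_pos/sqrt3_pos in unrelated modules; kept PRIVATE (private copies in the sequel parts that use them)) -/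
private theorem sqrt2_pos : 0 < Real.sqrt 2 := Real.sqrt_pos.2 (by norm_num)
/-- `sqrt3_pos` (docstring added by the landing lane; see the module docstring). [formal bookkeeping] (dedup gate: public twins Literature.Geometry.DiscreteGeometry.sqrt_two_sq/sqrt_three_sq (LayerShells, not imported here), …sqrt2_pos/sqrt3_pos in unrelated modules; kept PRIVATE (private copies in the sequel parts that use them)) -/
private theorem sqrt3_pos : 0 < Real.sqrt 3 := Real.sqrt_pos.2 (by norm_num)

/-- The rotation taking the stacking frame to the cubic frame: columns `(1,1,0)·√2/2`, `(−1,1,2)·√2√3/6`, `(1,−1,1)·√3/3`. -/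
def rotFun (z : E3) : E3 := WithLp.toLp 2 fun k : Fin 3 =>
  if k = 0 then Real.sqrt 2 / 2 * z 0 - Real.sqrt 2 * Real.sqrt 3 / 6 * z 1 + Real.sqrt 3 / 3 * z 2
  else if k = 1 then Real.sqrt 2 / 2 * z 0 + Real.sqrt 2 * Real.sqrt 3 / 6 * z 1 - Real.sqrt 3 / 3 * z 2
  else Real.sqrt 2 * Real.sqrt 3 / 3 * z 1 + Real.sqrt 3 / 3 * z 2

/-- `rotFun_apply_zero` (docstring added by the landing lane; see the module docstring). [formal bookkeeping] -/
@[simp] theorem rotFun_apply_zero (z : E3) :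
    rotFun z 0 = Real.sqrt 2 / 2 * z 0 - Real.sqrt 2 * Real.sqrt 3 / 6 * z 1 + Real.sqrt 3 / 3 * z 2 := rfl
/-- `rotFun_apply_one` (docstring added by the landing lane; see the module docstring). [formal bookkeeping] -/
@[simp] theorem rotFun_apply_one (z : E3) :
    rotFun z 1 = Real.sqrt 2 / 2 * z 0 + Real.sqrt 2 * Real.sqrt 3 / 6 * z 1 - Real.sqrt 3 / 3 * z 2 := rfl
/-- `rotFun_apply_two` (docstring added by the landing lane; see the module docstring). [formal bookkeeping] -/
@[simp] theorem rotFun_apply_two (z : E3) : rotFun z 2 = Real.sqrt 2 * Real.sqrt 3 / 3 * z 1 + Real.sqrt 3 / 3 * z 2 := rfl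

/-- The rotation as a linear map. -/
def rot : E3 →ₗ[ℝ] E3 where
  toFun := rotFun
  map_add' x y := by
    ext k; fin_cases k <;> simp <;> ring
  map_smul' c x := by
    ext k; fin_cases k <;> simp <;> ring

/-- `rot_apply` (docstring added by the landing lane; see the module docstring). [formal bookkeeping] -/
@[simp] theorem rot_apply (z : E3) : rot z = rotFun z := rfl

/-- ★ The rotation preserves the norm. -/
theorem norm_rot_sq (z : E3) : ‖rot z‖ ^ 2 = ‖z‖ ^ 2 := by
  rw [EuclideanSpace.real_norm_sq_eq, EuclideanSpace.real_norm_sq_eq]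
  simp only [Fin.sum_univ_three, rot_apply, rotFun_apply_zero, rotFun_apply_one, rotFun_apply_two]
  linear_combination (z 0 ^ 2 / 2 + z 1 ^ 2 * Real.sqrt 3 ^ 2 / 6) * sqrt2_sq + (z 1 ^ 2 / 3 + z 2 ^ 2 / 3) * sqrt3_sq

/-- `norm_rot` (docstring added by the landing lane; see the module docstring). [formal bookkeeping] -/
theorem norm_rot (z : E3) : ‖rot z‖ = ‖z‖ := by
  have h := norm_rot_sq z
  nlinarith [norm_nonneg (rot z), norm_nonneg z, sq_nonneg (‖rot z‖ - ‖z‖), sq_nonneg (‖rot z‖ + ‖z‖)]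

/-- ★ The rotation is an isometry. -/
theorem isometry_rot : Isometry (rot : E3 → E3) :=
  Isometry.of_dist_eq fun x y => by rw [dist_eq_norm, dist_eq_norm, ← map_sub, norm_rot]

/-- The nearest-neighbour spacing `a` corresponds to the cubic parameter `b = a/√2 = a√2/2`; the layer spacing is `h = a√(2/3) = a√2√3/3`. -/
def bOf (a : ℝ) : ℝ := a * Real.sqrt 2 / 2
/-- `hOf` (docstring added by the landing lane; see the module docstring). [formal bookkeeping] -/
def hOf (a : ℝ) : ℝ := a * Real.sqrt 2 * Real.sqrt 3 / 3

/-- `bOf_pos` (docstring added by the landing lane; see the module docstring). [formal bookkeeping] -/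
theorem bOf_pos {a : ℝ} (ha : 0 < a) : 0 < bOf a := by unfold bOf; positivity
/-- `hOf_pos` (docstring added by the landing lane; see the module docstring). [formal bookkeeping] -/
theorem hOf_pos {a : ℝ} (ha : 0 < a) : 0 < hOf a := by unfold hOf; positivity

/-- `hOf_sq` (docstring added by the landing lane; see the module docstring). [formal bookkeeping] -/
theorem hOf_sq (a : ℝ) : hOf a ^ 2 = 2 / 3 * a ^ 2 := by
  rw [hOf, div_pow, mul_pow, mul_pow, sqrt2_sq, sqrt3_sq]; ring

/-- `bOf_sq` (docstring added by the landing lane; see the module docstring). [formal bookkeeping] -/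
theorem bOf_sq (a : ℝ) : bOf a ^ 2 = a ^ 2 / 2 := by
  rw [bOf, div_pow, mul_pow, sqrt2_sq]; ring

/-- `bOf_mul_sqrt2` (docstring added by the landing lane; see the module docstring). [formal bookkeeping] -/
theorem bOf_mul_sqrt2 (a : ℝ) : bOf a * Real.sqrt 2 = a := by
  rw [bOf]
  linear_combination (a / 2) * sqrt2_sq

/-- ★ The rotation maps the Barlow positions of the constant Hägg sequence onto `b·D₃`:
`rot (barlowPos a h const k i j) = b·(i + k, i + j, j + k)`. -/
theorem rot_barlowPos (a : ℝ) (k i j : ℤ) :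
    rot (barlowPos a (hOf a) constHagg k i j) = vec (bOf a) ![i + k, i + j, j + k] := by
  ext m
  fin_cases m
  · simp [barlowPos, triangularVec₁, triangularVec₂, barlowOffset, layerNormal, hOf, bOf, vec]
    linear_combination (-(a * Real.sqrt 2 * ((j : ℝ) - k) / 12)) * sqrt3_sq
  · simp [barlowPos, triangularVec₁, triangularVec₂, barlowOffset, layerNormal, hOf, bOf, vec]
    linear_combination (a * Real.sqrt 2 * ((j : ℝ) - k) / 12) * sqrt3_sq
  · simp [barlowPos, triangularVec₁, triangularVec₂, barlowOffset, layerNormal, hOf, bOf, vec]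
    linear_combination (a * Real.sqrt 2 * ((j : ℝ) + k) / 6) * sqrt3_sq

end Barlow

/-! ## Image, Barlow image, separation, labelling -/

section Image

/-- ★ The rotation maps the fcc STACKING (Literature, stacking coordinates) onto the fcc configuration `b·D₃` (cubic coordinates). -/
theorem image_rot_fcc (a : ℝ) (ha : 0 < a) : (rot : E3 → E3) '' fccStacking a (hOf a) = (fccRef (bOf a) (bOf_pos ha)).points := by
  ext z
  constructor
  · rintro ⟨x, hx, rfl⟩
    obtain ⟨k, i, j, rfl⟩ := hx
    rw [rot_barlowPos]
    exact vec_mem_points (bOf_pos ha) ⟨i + j + k, by simp [Fin.sum_univ_three]; ring⟩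
  · intro hz
    obtain ⟨x, hx, rfl⟩ := (mem_points_iff_even _ _ z).1 hz
    refine ⟨barlowPos a (hOf a) constHagg (unmixM x 1) (unmixM x 2) (unmixM x 0), ⟨_, _, _, rfl⟩, ?_⟩
    rw [rot_barlowPos]
    have hm := mixM_unmixM hx
    congr 1
    funext m
    have h0 := congrFun hm 0
    have h1 := congrFun hm 1
    have h2 := congrFun hm 2
    simp only [mixM, Fin.sum_univ_three] at h0 h1 h2
    fin_cases m <;> simp <;> omega

/-- ★★ The fcc configuration at nearest-neighbour spacing `a ∈ [9/10, 11/10]` is a BARLOW IMAGE (the tree's `IsBarlowImage`, window included). -/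
theorem isBarlowImage_fcc {a : ℝ} (ha : 9 / 10 ≤ a ∧ a ≤ 11 / 10) :
    IsBarlowImage (fccRef (bOf a) (bOf_pos (by linarith [ha.1]))).points :=
  ⟨a, hOf a, constHagg, rot, ha, ⟨hOf_pos (by linarith [ha.1]), by rw [hOf_sq]; nlinarith, by rw [hOf_sq]; nlinarith⟩,
    isHaggSeq_const, isometry_rot, (image_rot_fcc a (by linarith [ha.1])).symm⟩

/-- Even-sum non-zero integer vectors have squared length `≥ 2`. -/
theorem two_le_nsq (n : D3) : 2 ≤ nsq n.1 := by
  obtain ⟨hn0, m, hm⟩ := n.2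
  have hN : (2 : ℤ) ≤ ∑ k, (n.1 k) ^ 2 := by
    have hpar : Even (∑ k, (n.1 k) ^ 2 - ∑ k, n.1 k) := by
      rw [← Finset.sum_sub_distrib]
      refine Finset.even_sum _ fun k _ => ?_
      have : (n.1 k) ^ 2 - n.1 k = (n.1 k - 1) * (n.1 k - 1 + 1) := by ring
      rw [this]; exact Int.even_mul_succ_self _
    have hpos : (1 : ℤ) ≤ ∑ k, (n.1 k) ^ 2 := by
      have h1 := one_le_nsq n
      unfold nsq at h1
      exact_mod_cast h1
    obtain ⟨r, hr⟩ := hpar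
    omega
  unfold nsq
  exact_mod_cast hN

/-- `sub_mem_lattice` (docstring added by the landing lane; see the module docstring). [formal bookkeeping] -/
theorem sub_mem_lattice {b : ℝ} (hb : 0 < b) {y z : E3} (hy : y ∈ (fccRef b hb).points) (hz : z ∈ (fccRef b hb).points) :
    y - z ∈ (fccRef b hb).lattice :=
  (fccRef b hb).lattice.sub_mem ((mem_points_iff_lattice b hb y).1 hy) ((mem_points_iff_lattice b hb z).1 hz)

/-- ★ The fcc configuration `b·D₃` is `b√2`-SEPARATED (nearest-neighbour distance). -/
theorem fcc_separated (b : ℝ) (hb : 0 < b) : IsSeparatedRef (b * Real.sqrt 2) (fccRef b hb) := by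
  intro y hy z hz hyz
  obtain ⟨x, hx, hxe⟩ := (mem_points_iff_even b hb _).1 ((mem_points_iff_lattice b hb _).2 (sub_mem_lattice hb hy hz))
  have hx0 : x ≠ 0 := fun h => hyz (sub_eq_zero.1 (by rw [hxe, h, vec_zero]))
  rw [dist_eq_norm, hxe, norm_vec b hb]
  have h2 := two_le_nsq ⟨x, hx0, hx⟩
  exact mul_le_mul_of_nonneg_left (Real.sqrt_le_sqrt h2) hb.le

/-- `smul_vec` (docstring added by the landing lane; see the module docstring). [formal bookkeeping] -/
theorem smul_vec (t b : ℝ) (x : Fin 3 → ℤ) : t • vec b x = vec (t * b) x := by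
  ext k; simp; ring

/-- ★ LABELLING BY SCALING: the fcc configuration at parameter `b` is labelled by the Barlow image at parameter `b'` through the
homothety `x ↦ (b/b')·x`, with strain `|b/b' − 1|`. -/
theorem fcc_labelledWithin {b b' lam ℓ : ℝ} (hb : 0 < b) (hb' : 0 < b') (hS : IsBarlowImage (fccRef b' hb').points)
    (ht : |b / b' - 1| ≤ lam) (ht2 : 1 / 2 ≤ b / b') : LabelledWithin lam ℓ (fccRef b hb) 0 := by
  have hbb : b / b' * b' = b := div_mul_cancel₀ b hb'.ne'
  refine ⟨(fccRef b' hb').points, hS, fun x => (b / b') • x, 0, ?_, by simp, ?_, ?_, ?_⟩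
  · have := vec_mem_points hb' (x := 0) ⟨0, by simp⟩
    rwa [vec_zero] at this
  · intro x hx _
    obtain ⟨y, hy, rfl⟩ := (mem_points_iff_even b' hb' x).1 hx
    show (b / b') • vec b' y ∈ (fccRef b hb).points
    rw [smul_vec, hbb]
    exact vec_mem_points hb hy
  · intro q hq hqd
    obtain ⟨y, hy, rfl⟩ := (mem_points_iff_even b hb q).1 hq
    refine ⟨(b' / b) • vec b y, ?_, ?_, ?_⟩
    · rw [smul_vec, div_mul_cancel₀ b' hb.ne']; exact vec_mem_points hb' hy
    · rw [dist_eq_norm, sub_zero, norm_smul, Real.norm_eq_abs, abs_of_pos (div_pos hb' hb)]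
      rw [dist_eq_norm, sub_zero] at hqd
      have hr : b' / b ≤ 2 := by
        rw [div_le_iff₀ hb]
        have := (le_div_iff₀ hb').1 ht2
        linarith
      calc b' / b * ‖vec b y‖ ≤ 2 * (ℓ / 2) := mul_le_mul hr hqd (norm_nonneg _) (by norm_num)
        _ = ℓ := by ring
    · show (b / b') • (b' / b) • vec b y = vec b y
      rw [smul_smul, div_mul_div_comm, mul_comm b b', div_self (mul_ne_zero hb'.ne' hb.ne'), one_smul]
  · intro x _ x' _ _ _
    have : (b / b') • x - (b / b') • x' - (x - x') = (b / b' - 1) • (x - x') := by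
      rw [sub_smul, one_smul, smul_sub]
    rw [this, norm_smul, Real.norm_eq_abs]
    exact mul_le_mul_of_nonneg_right ht (norm_nonneg _)

/-- ★ … hence `IsLabelledRef lam ℓ` (one-point motif). -/
theorem fcc_labelled {b b' lam ℓ : ℝ} (hb : 0 < b) (hb' : 0 < b') (hS : IsBarlowImage (fccRef b' hb').points)
    (ht : |b / b' - 1| ≤ lam) (ht2 : 1 / 2 ≤ b / b') : IsLabelledRef lam ℓ (fccRef b hb) := by
  intro y hy
  rw [fccRef_motif, Finset.mem_singleton] at hy
  subst hy
  exact fcc_labelledWithin hb hb' hS ht ht2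

end Image

end Fcc

end Summit.AtomisticToContinuum.Crystallization.Theorems.ChargedEnergyGapChartDial

end
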